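import Mathlib
import Summits.SmoothPoincare4.SmoothPoincare4.Theses.CongruenceShadows
import Summits.SmoothPoincare4.SmoothPoincare4.Theorems.ShadowsStandard.Negative.ShadowLevels
import Summits.SmoothPoincare4.SmoothPoincare4.Theorems.WaldhausenPairs.Negative.PairTransferFalse
import Summits.SmoothPoincare4.SmoothPoincare4.Theorems.WaldhausenPairs.Negative.StandardPairSymmetries

/-!
# Line `power-twist-absorption` — skeleton for the crux `ShadowsStandard` (stmt-SmoothPoincare4-14593)

Route `CongruenceShadows`, crux decl
`Summit.SmoothPoincare4.SmoothPoincare4.Theses.CongruenceShadows.ShadowsStandard`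
(for every `m`, every `(3+3m; m+1)` group trisection `K` of the trivial group and every
characteristic finite-index `M ≤ S = S_{3+3m}` some `ψ ∈ Aut S` has `ψ(Nᵢ)·M = Kᵢ·M`,
`N = s4Kernels.stabilizeIter m`). Idea card `Cruxes/ShadowsStandard/Ideas/power-twist-absorption.md`
(crux-ideate r1, ideator 1; triage r1: pass ×3).

## The line (two registered stubs + the route item `WaldhausenPairs`, composed WITHOUT `sorry`)

* `stub_powerTwistGate` (= `PowerTwistGate`, the card's Transfer `C⁺`, the MOD-`e` GATE; hardest):
  after Waldhausen normalisation `K = (N₀, N₁, K₂)`, for every `e ≥ 2` the third kernel is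
  `K₂ = y(t(c(N₂)))` with `y` in the Goeritz group `A ∩ B = Stab N₀ ∩ Stab N₁` EXACTLY, `c` in the
  handlebody group `C = Stab N₂` EXACTLY, and `t` in the POWER SUBGROUP `powerTwists m e ◁ Aut S`
  — the normal closure of the `e`-th powers of all (based) Dehn-twist automorphisms — i.e.
  `ρ ∈ (A∩B)·Mod_g[e]·C` for the gate locus; equivalently, in Funar's power quotient
  `Γ_g(e) = Mod_g/Mod_g[e]`, `Im(gate locus) ⊆ Im(A∩B)·Im(C)`.
* `stub_twistAbsorption` (= `TwistAbsorption`, the card's LEVER; provable now, size M): if `M` is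
  characteristic and `s ^ e ∈ M` for all `s` (i.e. `exp(S/M) ∣ e`) then every element of
  `powerTwists m e` is congruent to the identity modulo `M` (`CongruentMod M t : ∀ s, t s · s⁻¹ ∈ M`).
  This is where `M.Characteristic` is consumed (conjugation invariance `CongruentMod.conj`, proved
  below); the base case is the one-line computation `T₀^e : b₁ ↦ b₁ a₁^e ≡ b₁`, resp. partial
  conjugation by `w_h^e ∈ M`.
* proved here (no `sorry`): `CongruentMod` is a subgroup condition, normal under `Aut S` for
  characteristic `M` (`congruenceKernel`, `congruenceKernel_normal`), generated-by criterion
  (`congruentMod_of_generators`); twist absorption fixes shadows (`map_sup_eq_of_congruentMod`);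
  the mod-`M` gate criterion (`shadowStandardAt_of_gateFactorisation`, from the ideator's sketch);
  `exists_exponent` (FiniteIndex ⇒ some `e ≥ 2` kills `S/M` — where `M.FiniteIndex` is consumed);
  `congruenceGate_of : PowerTwistGate → TwistAbsorption → CongruenceGate` (the mod-`M` gate with `t`
  ANY `M`-congruent automorphism — the weaker fallback gate of the line, kept as a named `Prop`);
  transport along the pair-normaliser (`shadowStandardAt_of_pair`, using the landed
  `IsGroupTrisection.map_mulEquiv`); and the composition
  `ShadowsStandard_of : stub_powerTwistGate → stub_twistAbsorption → WaldhausenPairs → ShadowsStandard`.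
  Non-vacuity at genus 3: the tree's Dehn twist `dehnEquiv 0 : b₁ ↦ b₁a₁` IS a standard twist in the
  sense of `IsStdTwist` (`isStdTwist_dehnEquiv_zero`), so `(dehnEquiv 0)^e ∈ powerTwists 0 e`.
* two further REGISTERED rungs of the hardest stub (special cases, proved to follow from it in
  `rungs_of_powerTwistGate`; not hypotheses of the composition): `stub_gate_exponentTwo` (`e = 2`, all
  `m`: the abelian/Sp(2g,𝔽₂) calibration — Humphries Prop 2.1 `⟪T²⟫ = Mod_g[2]` = level-2 kernel — modulo
  the Goeritz-image lemma `Im(A∩B → Sp) = Stab L̄₀ ∩ Stab L̄₁` asked for by triage r1-1/r1-3) and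
  `stub_gate_genusThree_exponentThree` (`m = 0`, `e = 3`: a FINITE double-coset problem in Humphries'
  finite group `Mod₃/⟪T³⟫ ≅ (ℤ/3)¹⁴ ⋊ Sp(6,𝔽₃)`-sized quotient, Humphries 1992 Thm 2).

## Disproof used (`Cruxes/ShadowsStandard/Disproof.lean`, cdisprove cycle 1, NO KILL; conclusive parts landed as
`Theorems/ShadowsStandard/Negative/ShadowLevels.lean`, imported here)

* `shadowsStandard_false_without_characteristic` — honoured: `Characteristic` is used at
  `stub_twistAbsorption` (via `CongruentMod.conj`) and in the transport step (`M.map α = M`).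
* `shadowsStandard_false_without_trisection` — honoured: `IsGroupTrisection` is a hypothesis of
  `stub_powerTwistGate` (the gate is claimed on the gate locus only) and feeds `WaldhausenPairs`.
* `shadowsStandard_without_finiteIndex_iff_unstable` — honoured: `FiniteIndex` is consumed in
  `exists_exponent`; at `M = ⊥` no `e ≥ 2` with `s^e ∈ ⊥` exists and the line says nothing.
* `shadowsStandard_uniform_iff_unstable` (one `ψ` for all `M` = UnstableStandard) — respected: the
  witness `ψ = y ∘ α⁻¹`-type automorphism depends on `e`, hence on `M`.
* Disproof finding 5 (bare level gate for level STABILISERS false at the abelian level) — respected: no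
  level stabiliser of a single handlebody occurs; `y ∈ A∩B` and `c ∈ C` are exact, all slack is in `t`.
* `ShadowStandardAt.mono` / levels: not needed (the gate is used at every `M` directly).
* Landed Negative lemmas of the sibling cruxes imported for the scratch check: `PairTransferFalse`
  (`not_pairTransfer`, `not_rigid`), `StandardPairSymmetries` (`not_pairsDetermineThird`: `dehnEquiv 0 ∈ A∩B`
  moves `N₂` — consistent: the gate puts such elements in `y`, not in `t`).
-/

set_option linter.dupNamespace false

noncomputable section

namespace Summit.SmoothPoincare4.SmoothPoincare4.Cruxes.ShadowsStandard.PowerTwistAbsorption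

open Literature.Topology.FourManifolds Subgroup
open Summit.SmoothPoincare4.SmoothPoincare4.Theses.CongruenceShadows
open Summit.SmoothPoincare4.SmoothPoincare4.Theorems.ShadowsStandard.Negative (N ShadowStandardAt)
open Summit.SmoothPoincare4.SmoothPoincare4.Theorems.WaldhausenPairs.Negative
  (dehnEquiv dehnEquiv_a dehnEquiv_b_of_ne dehnEquiv_b_self)

/-- The surface group of the crux at parameter `m` (genus `3 + 3m`). -/
abbrev Sg (m : ℕ) : Type := SurfaceGroup (3 + 3 * m)

/-! ## §1 Congruence modulo a level `M` -/

/-- `φ ≡ id (mod M)`: `φ(s)·s⁻¹ ∈ M` for all `s` — the algebraic shadow of the level-`M`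
congruence kernel of `Aut S` (for `M` characteristic: the kernel of `Aut S → Aut (S/M)`). -/
def CongruentMod {m : ℕ} (M : Subgroup (Sg m)) (φ : Sg m ≃* Sg m) : Prop :=
  ∀ s : Sg m, φ s * s⁻¹ ∈ M

theorem congruentMod_one {m : ℕ} (M : Subgroup (Sg m)) : CongruentMod M 1 := by
  intro s
  simp [M.one_mem]

theorem CongruentMod.mul {m : ℕ} {M : Subgroup (Sg m)} {φ ψ : Sg m ≃* Sg m}
    (hφ : CongruentMod M φ) (hψ : CongruentMod M ψ) : CongruentMod M (φ * ψ) := by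
  intro s
  have h : (φ * ψ) s * s⁻¹ = (φ (ψ s) * (ψ s)⁻¹) * (ψ s * s⁻¹) := by
    rw [MulAut.mul_apply]; group
  rw [h]
  exact M.mul_mem (hφ (ψ s)) (hψ s)

theorem CongruentMod.inv {m : ℕ} {M : Subgroup (Sg m)} {φ : Sg m ≃* Sg m}
    (hφ : CongruentMod M φ) : CongruentMod M φ⁻¹ := by
  intro s
  have h1 : φ (φ⁻¹ s) * (φ⁻¹ s)⁻¹ ∈ M := hφ (φ⁻¹ s)
  rw [MulAut.apply_inv_self] at h1
  have h2 := M.inv_mem h1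
  simpa using h2

/-- Conjugation invariance — the step where `M.Characteristic` is consumed
(`T_{φ(γ)}^e = φ T_γ^e φ⁻¹ ≡ id mod φ(M) = M`). -/
theorem CongruentMod.conj {m : ℕ} {M : Subgroup (Sg m)} (hM : M.Characteristic)
    {φ : Sg m ≃* Sg m} (hφ : CongruentMod M φ) (α : Sg m ≃* Sg m) :
    CongruentMod M (α * φ * α⁻¹) := by
  intro s
  have h1 : φ (α⁻¹ s) * (α⁻¹ s)⁻¹ ∈ M := hφ _
  have h2 : φ (α⁻¹ s) * (α⁻¹ s)⁻¹ ∈ M.comap α.toMonoidHom := by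
    rw [hM.fixed α]; exact h1
  rw [Subgroup.mem_comap] at h2
  simpa [MulAut.mul_apply, map_mul, map_inv, MulAut.apply_inv_self] using h2

/-- The level-`M` congruence kernel as a subgroup of `Aut S` (no hypothesis on `M`). -/
def congruenceKernel {m : ℕ} (M : Subgroup (Sg m)) : Subgroup (Sg m ≃* Sg m) where
  carrier := {φ | CongruentMod M φ}
  mul_mem' := fun ha hb => CongruentMod.mul ha hb
  one_mem' := congruentMod_one M
  inv_mem' := fun ha => CongruentMod.inv ha

@[simp] theorem mem_congruenceKernel {m : ℕ} {M : Subgroup (Sg m)} {φ : Sg m ≃* Sg m} :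
    φ ∈ congruenceKernel M ↔ CongruentMod M φ := Iff.rfl

/-- For characteristic `M` the congruence kernel is normal in `Aut S`. -/
theorem congruenceKernel_normal {m : ℕ} {M : Subgroup (Sg m)} (hM : M.Characteristic) :
    (congruenceKernel M).Normal :=
  ⟨fun _ hφ α => CongruentMod.conj hM hφ α⟩

/-- Generator criterion: for NORMAL `M`, congruence on the `2g` standard generators suffices. -/
theorem congruentMod_of_generators {m : ℕ} {M : Subgroup (Sg m)} [M.Normal] {φ : Sg m ≃* Sg m}
    (h : ∀ x : surfaceGen (3 + 3 * m),
      φ (PresentedGroup.of x) * (PresentedGroup.of x)⁻¹ ∈ M) :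
    CongruentMod M φ := by
  let H : Subgroup (Sg m) :=
    { carrier := {s | φ s * s⁻¹ ∈ M}
      mul_mem' := by
        intro s t hs ht
        have e : φ (s * t) * (s * t)⁻¹ = (φ s * s⁻¹) * (s * (φ t * t⁻¹) * s⁻¹) := by
          rw [map_mul]; group
        change φ (s * t) * (s * t)⁻¹ ∈ M
        rw [e]
        exact M.mul_mem hs (Subgroup.Normal.conj_mem inferInstance _ ht s)
      one_mem' := by
        change φ 1 * (1 : Sg m)⁻¹ ∈ M
        simp [M.one_mem]
      inv_mem' := by
        intro s hs
        change φ s⁻¹ * s⁻¹⁻¹ ∈ M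
        have h1 : s * (φ s)⁻¹ ∈ M := by simpa using M.inv_mem hs
        have h2 : s⁻¹ * (s * (φ s)⁻¹) * s⁻¹⁻¹ ∈ M := Subgroup.Normal.conj_mem inferInstance _ h1 s⁻¹
        simpa [map_inv, mul_assoc] using h2 }
  intro s
  exact PresentedGroup.generated_by _ H h s

/-- **Twist absorption fixes shadows** (ideator's first lemma): an automorphism congruent to the
identity modulo `M` fixes every level-`M` shadow `K ⊔ M`. -/
theorem map_sup_eq_of_congruentMod {m : ℕ} (M : Subgroup (Sg m)) (φ : Sg m ≃* Sg m)
    (hφ : CongruentMod M φ) (K : Subgroup (Sg m)) :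
    (K ⊔ M).map φ.toMonoidHom = K ⊔ M := by
  apply le_antisymm
  · rintro _ ⟨x, hx, rfl⟩
    have h1 : φ x * x⁻¹ ∈ K ⊔ M := Subgroup.mem_sup_right (hφ x)
    have h2 : (φ x * x⁻¹) * x ∈ K ⊔ M := Subgroup.mul_mem _ h1 hx
    simpa using h2
  · intro x hx
    refine ⟨φ.symm x, ?_, by simp⟩
    have h1 : φ (φ.symm x) * (φ.symm x)⁻¹ ∈ M := hφ (φ.symm x)
    rw [MulEquiv.apply_symm_apply] at h1
    have h2 : (x * (φ.symm x)⁻¹)⁻¹ * x ∈ K ⊔ M :=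
      Subgroup.mul_mem _ (Subgroup.inv_mem _ (Subgroup.mem_sup_right h1)) hx
    have h3 : (x * (φ.symm x)⁻¹)⁻¹ * x = φ.symm x := by group
    simpa [h3] using h2

/-- A congruent automorphism maps `M` onto itself. -/
theorem map_eq_of_congruentMod {m : ℕ} (M : Subgroup (Sg m)) (φ : Sg m ≃* Sg m)
    (hφ : CongruentMod M φ) : M.map φ.toMonoidHom = M := by
  simpa using map_sup_eq_of_congruentMod M φ hφ M

/-! ## §2 Dehn-twist automorphisms (by generator data) and the power subgroup `Mod_g[e]` -/

/-- The index of the first handle of `Σ_{3+3m}`. -/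
def h0 (m : ℕ) : Fin (3 + 3 * m) := ⟨0, by omega⟩

/-- `T` is THE standard transvection `t_{a₁}`: `b₁ ↦ b₁ a₁`, every other standard generator fixed —
the automorphism of `S` induced (for a suitable base-point convention) by the Dehn twist about the
non-separating curve `a₁`; it fixes `[a₁,b₁]` letter for letter. At genus 3 it is the tree's
`dehnEquiv 0` (`isStdTwist_dehnEquiv_zero`). -/
def IsStdTwist {m : ℕ} (T : Sg m ≃* Sg m) : Prop :=
  ∀ x : surfaceGen (3 + 3 * m),
    T (PresentedGroup.of x) =
      if x = (h0 m, true) then PresentedGroup.of (h0 m, true) * PresentedGroup.of (h0 m, false)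
      else PresentedGroup.of x

/-- The boundary word `w_h = ∏_{i<h} [aᵢ, bᵢ]` of the first `h` handles (a separating curve `δ_h`
for `1 ≤ h ≤ g-1`; `w_g` is the surface relator, `= 1`). -/
def boundaryWord (m h : ℕ) : Sg m :=
  PresentedGroup.mk _ ((((List.finRange (3 + 3 * m)).filter fun i => i.val < h).map
    fun i => genA i * genB i * (genA i)⁻¹ * (genB i)⁻¹).prod)

/-- `T` is the partial conjugation by `w_h` on the first `h` handles — the automorphism induced (up to
an inner automorphism) by the Dehn twist about the separating curve `δ_h`. -/
def IsSepTwist {m : ℕ} (h : ℕ) (T : Sg m ≃* Sg m) : Prop :=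
  ∀ x : surfaceGen (3 + 3 * m),
    T (PresentedGroup.of x) =
      if x.1.val < h then boundaryWord m h * PresentedGroup.of x * (boundaryWord m h)⁻¹
      else PresentedGroup.of x

/-- Based Dehn-twist automorphisms of `S`: the `Aut S`-conjugates of the standard non-separating
transvection and of the separating partial conjugations (change of coordinates: every simple
closed curve is `φ(a₁)` or `φ(δ_h)`; orientation-reversing `φ` supply the inverse twists). -/
def IsDehnTwist {m : ℕ} (T : Sg m ≃* Sg m) : Prop :=
  ∃ φ T₀ : Sg m ≃* Sg m, (IsStdTwist T₀ ∨ ∃ h : ℕ, IsSepTwist h T₀) ∧ T = φ * T₀ * φ⁻¹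

/-- **The power subgroup** `powerTwists m e ◁ Aut S_{3+3m}`: the normal closure of the `e`-th powers
of all based Dehn-twist automorphisms. Its image in `Out S = Mod^±_g` is Funar's `Mod_g[e]`;
`Aut S ⧸ powerTwists m e` is the (based) power quotient `Γ_g(e)`. -/
def powerTwists (m e : ℕ) : Subgroup (Sg m ≃* Sg m) :=
  Subgroup.normalClosure {t | ∃ T : Sg m ≃* Sg m, IsDehnTwist T ∧ t = T ^ e}

/-- `Mod_g[e]` is normal in `Aut S` (it is a normal closure). -/
instance powerTwists_normal (m e : ℕ) : (powerTwists m e).Normal := by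
  unfold powerTwists; infer_instance

/-- Non-vacuity at genus 3: the tree's Dehn twist `dehnEquiv 0 : b₁ ↦ b₁a₁` (landed in
`Theorems/WaldhausenPairs/Negative/StandardPairSymmetries.lean`) is a standard twist. -/
theorem isStdTwist_dehnEquiv_zero : IsStdTwist (m := 0) (dehnEquiv 0) := by
  intro x
  obtain ⟨k, c⟩ := x
  have hk0 : (h0 0 : Fin 3) = 0 := rfl
  cases c with
  | false =>
    rw [if_neg (by simp)]
    exact dehnEquiv_a 0 k
  | true =>
    by_cases hk : k = 0
    · subst hk
      rw [if_pos (by simp [hk0])]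
      exact dehnEquiv_b_self 0
    · rw [if_neg (by simp [hk0, hk])]
      exact dehnEquiv_b_of_ne hk

/-- Hence `dehnEquiv 0` is a Dehn-twist automorphism in the sense of `IsDehnTwist` … -/
theorem isDehnTwist_dehnEquiv_zero : IsDehnTwist (m := 0) (dehnEquiv 0) :=
  ⟨1, dehnEquiv 0, Or.inl isStdTwist_dehnEquiv_zero, by simp⟩

/-- … and its `e`-th power lies in `powerTwists 0 e`. -/
theorem dehnEquiv_zero_pow_mem_powerTwists (e : ℕ) :
    (dehnEquiv 0) ^ e ∈ powerTwists 0 e :=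
  Subgroup.subset_normalClosure ⟨dehnEquiv 0, isDehnTwist_dehnEquiv_zero, rfl⟩

/-! ### The lever on the tree's own twist (genus 3): `(dehnEquiv 0)^e : b₁ ↦ b₁a₁^e` is congruent to
`id` modulo every NORMAL `M` with `a₁^e ∈ M` — the base case of `stub_twistAbsorption`, proved. -/

theorem pow_dehnEquiv_zero_a (e : ℕ) (i : Fin 3) :
    ((dehnEquiv 0) ^ e) (SurfaceGroup.a i) = SurfaceGroup.a i := by
  induction e with
  | zero => simp
  | succ n ih => rw [pow_succ, MulAut.mul_apply, dehnEquiv_a, ih]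

theorem pow_dehnEquiv_zero_b_of_ne (e : ℕ) {i : Fin 3} (hi : i ≠ 0) :
    ((dehnEquiv 0) ^ e) (SurfaceGroup.b i) = SurfaceGroup.b i := by
  induction e with
  | zero => simp
  | succ n ih => rw [pow_succ, MulAut.mul_apply, dehnEquiv_b_of_ne hi, ih]

theorem pow_dehnEquiv_zero_b_zero (e : ℕ) :
    ((dehnEquiv 0) ^ e) (SurfaceGroup.b 0) = SurfaceGroup.b 0 * SurfaceGroup.a 0 ^ e := by
  induction e with
  | zero => simp
  | succ n ih =>
    rw [pow_succ, MulAut.mul_apply, dehnEquiv_b_self, map_mul, ih, pow_dehnEquiv_zero_a, pow_succ,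
      mul_assoc]

/-- Base case of the lever at genus 3, on the tree's twist: if `M ◁ S₃` contains `a₁^e` then
`(dehnEquiv 0)^e ≡ id (mod M)`. -/
theorem congruentMod_pow_dehnEquiv_zero (M : Subgroup (Sg 0)) [M.Normal] (e : ℕ)
    (he : SurfaceGroup.a (0 : Fin 3) ^ e ∈ M) : CongruentMod M ((dehnEquiv 0) ^ e) := by
  refine congruentMod_of_generators ?_
  rintro ⟨k, c⟩
  cases c with
  | false =>
    change ((dehnEquiv 0) ^ e) (SurfaceGroup.a k) * (SurfaceGroup.a k)⁻¹ ∈ M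
    rw [pow_dehnEquiv_zero_a, mul_inv_cancel]
    exact M.one_mem
  | true =>
    change ((dehnEquiv 0) ^ e) (SurfaceGroup.b k) * (SurfaceGroup.b k)⁻¹ ∈ M
    by_cases hk : k = 0
    · subst hk
      rw [pow_dehnEquiv_zero_b_zero]
      exact Subgroup.Normal.conj_mem inferInstance _ he _
    · rw [pow_dehnEquiv_zero_b_of_ne e hk, mul_inv_cancel]
      exact M.one_mem

/-! ## §3 The statements of the line -/

/-- STUB 1 statement — **the mod-`e` gate** (card Transfer `C⁺`): for every `e ≥ 2` and every
Waldhausen-normalised `(3+3m; m+1)` group trisection `K = (N₀, N₁, K₂)` of the trivial group,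
`K₂ = y(t(c(N₂))))` with `y ∈ Stab N₀ ∩ Stab N₁` (Goeritz group of the spine, EXACT), `c ∈ Stab N₂`
(handlebody group, EXACT) and `t ∈ powerTwists m e = Mod_g[e]`. -/
def PowerTwistGate : Prop :=
  ∀ (m e : ℕ), 2 ≤ e → ∀ K : TrisectionKernels (3 + 3 * m),
    IsGroupTrisection (3 + 3 * m) (m + 1) (PUnit : Type) K → K 0 = N m 0 → K 1 = N m 1 →
    ∃ y t c : Sg m ≃* Sg m,
      (N m 0).map y.toMonoidHom = N m 0 ∧ (N m 1).map y.toMonoidHom = N m 1 ∧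
      t ∈ powerTwists m e ∧ (N m 2).map c.toMonoidHom = N m 2 ∧
      K 2 = (((N m 2).map c.toMonoidHom).map t.toMonoidHom).map y.toMonoidHom

/-- STUB 2 statement — **power-twist absorption** (the lever): for `M` characteristic with
`s ^ e ∈ M` for all `s` (i.e. `exp(S/M) ∣ e`), every element of `Mod_g[e]` is congruent to the
identity modulo `M`. -/
def TwistAbsorption : Prop :=
  ∀ (m e : ℕ) (M : Subgroup (Sg m)), M.Characteristic → (∀ s : Sg m, s ^ e ∈ M) →
    ∀ t : Sg m ≃* Sg m, t ∈ powerTwists m e → CongruentMod M t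

/-- The **mod-`M` gate** (weaker, fallback form of the line; derived from the two stubs in
`congruenceGate_of`): as `PowerTwistGate` but with `t` ANY automorphism congruent to `id` modulo the
given characteristic finite-index `M`. -/
def CongruenceGate : Prop :=
  ∀ (m : ℕ) (K : TrisectionKernels (3 + 3 * m)),
    IsGroupTrisection (3 + 3 * m) (m + 1) (PUnit : Type) K → K 0 = N m 0 → K 1 = N m 1 →
    ∀ M : Subgroup (Sg m), M.Characteristic → M.FiniteIndex →
    ∃ y t c : Sg m ≃* Sg m,
      (N m 0).map y.toMonoidHom = N m 0 ∧ (N m 1).map y.toMonoidHom = N m 1 ∧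
      CongruentMod M t ∧ (N m 2).map c.toMonoidHom = N m 2 ∧
      K 2 = (((N m 2).map c.toMonoidHom).map t.toMonoidHom).map y.toMonoidHom

/-! ## §4 The registered stubs (`sorry` lives only in `stub_*`)

Lead reshape (prover-line seat, cycle 1): the planner's lever `stub_twistAbsorption` is now PROVED below
(`twistAbsorption_holds`) from three small DEF-FREE registered pieces (`stub_transvectionPowCongruent`,
`stub_partialConjPowCongruent`, `stub_conjOnClosure` — stated over the tree's `SurfaceGroup` only, so
they land as pure proofs under `Theorems/`); the two rungs of the gate are kept as named `Prop`s
(`RungExponentTwo`, `RungGenusThreeExponentThree`, special cases by `rungs_of_powerTwistGate`) and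
three def-free GOERITZ GENERATOR stubs (`stub_goeritzSigma23/S1/S2`: explicit automorphisms of `S₃`
in `Stab N₀ ∩ Stab N₁` with prescribed face action on `F₃ = S₃ ⧸ N₀`, formulas verified in the free
group in this seat, `comp/fg.py`) are registered as the first infrastructure of the `(0,3)` rung /
of the `m = 0` face normal form (Euclid on `F₃`), shared with lines finitary-ac (Stub 2) and luft. -/

/-- **STUB 1 · `stub_powerTwistGate`** (= `PowerTwistGate` verbatim; HARDEST, held by the lead; the
card's Transfer `C⁺`): the gate locus lies in `(A∩B)·Mod_g[e]·C` for every `e ≥ 2`. Why plausibly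
true: `e = 2` is the abelian rung (Humphries Prop 2.1: `Mod_g[2]` = level-2 kernel; Lagrangian triples
of homotopy-sphere trisections are standard); for `m = 0, e = 3` it is a finite computation (Humphries
Thm 2); in general `Mod_g[e]` has infinite index but the handlebody images in `Γ_g(e)` keep infinite
index (Funar arXiv:2009.05961 Prop 2.7). Why it might fail: it is TQFT-visible (SO(3) vacuum-vector
triples at level `p ∣ e`), so one trisection of `S⁴` with a non-standard vacuum triple kills it; and
for EVERY `e` at once it says the Waldhausen element `α_K ∈ A ∩ BC` lies in the closure of `(A∩B)C`
for the power topology `{Mod_g[e]}` of `Aut S`, which is much finer than the congruence topology the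
crux needs. Size XL / open. -/
theorem stub_powerTwistGate :
    ∀ (m e : ℕ), 2 ≤ e → ∀ K : TrisectionKernels (3 + 3 * m),
      IsGroupTrisection (3 + 3 * m) (m + 1) (PUnit : Type) K → K 0 = N m 0 → K 1 = N m 1 →
      ∃ y t c : Sg m ≃* Sg m,
        (N m 0).map y.toMonoidHom = N m 0 ∧ (N m 1).map y.toMonoidHom = N m 1 ∧
        t ∈ powerTwists m e ∧ (N m 2).map c.toMonoidHom = N m 2 ∧
        K 2 = (((N m 2).map c.toMonoidHom).map t.toMonoidHom).map y.toMonoidHom := by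
  sorry

/-- **STUB 2a · `stub_transvectionPowCongruent`** (absorption piece, def-free, any genus): if an
automorphism `T` of `S_g` acts on the standard generators as the transvection `b_i ↦ b_i a_i` (all
other generators fixed) and `a_i ^ e` lies in the NORMAL subgroup `M`, then `T ^ e ≡ id (mod M)`:
`T^e(b_i) b_i⁻¹ = b_i a_i^e b_i⁻¹ ∈ M`. (Template: `congruentMod_pow_dehnEquiv_zero` above, genus 3.) -/
theorem stub_transvectionPowCongruent :
    ∀ (g e : ℕ) (i : Fin g) (M : Subgroup (SurfaceGroup g)), M.Normal →
      ∀ T : SurfaceGroup g ≃* SurfaceGroup g,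
      (∀ x : surfaceGen g, T (PresentedGroup.of x) =
          if x = (i, true) then PresentedGroup.of (i, true) * PresentedGroup.of (i, false)
          else PresentedGroup.of x) →
      (PresentedGroup.of (i, false) : SurfaceGroup g) ^ e ∈ M →
      ∀ s : SurfaceGroup g, (T ^ e) s * s⁻¹ ∈ M := by
  -- LANDED (wave 1, p80570, ACCEPTED) as Summit.SmoothPoincare4.SmoothPoincare4.Theorems.ShadowsStandard.PowerTwistAbsorption.stub_transvectionPowCongruent;
  -- kept as `sorry` in this registration copy only until the farm has BUILT that module (import then discharges it,
  -- see work/ShadowsStandard.lean); nothing to prove here.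
  sorry

/-- **STUB 2b · `stub_partialConjPowCongruent`** (absorption piece, def-free, any genus): if `T` acts
on each standard generator either as conjugation by a fixed `w` or trivially, fixes `w`, and `w ^ e`
lies in the NORMAL subgroup `M`, then `T ^ e ≡ id (mod M)`: `T^e(x) x⁻¹ = w^e (x w^{-e} x⁻¹) ∈ M` on
conjugated generators. -/
theorem stub_partialConjPowCongruent :
    ∀ (g e : ℕ) (P : surfaceGen g → Prop) [DecidablePred P] (w : SurfaceGroup g)
      (M : Subgroup (SurfaceGroup g)), M.Normal →
      ∀ T : SurfaceGroup g ≃* SurfaceGroup g,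
      (∀ x : surfaceGen g, T (PresentedGroup.of x) =
          if P x then w * PresentedGroup.of x * w⁻¹ else PresentedGroup.of x) →
      T w = w → w ^ e ∈ M →
      ∀ s : SurfaceGroup g, (T ^ e) s * s⁻¹ ∈ M := by
  -- LANDED (wave 1, p79408, ACCEPTED) as Summit.SmoothPoincare4.SmoothPoincare4.Theorems.ShadowsStandard.PowerTwistAbsorption.stub_partialConjPowCongruent;
  -- kept as `sorry` in this registration copy only until the farm has BUILT that module (import then discharges it,
  -- see work/ShadowsStandard.lean); nothing to prove here.
  sorry

/-- **STUB 2c · `stub_conjOnClosure`** (absorption piece, def-free, any genus): if `T` acts as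
conjugation by `w` on every standard generator satisfying `P`, then it acts as conjugation by `w` on
the whole subgroup those generators generate (used with `w = w_h`, the boundary word of the first `h`
handles, which lies in that subgroup, to get `T w_h = w_h`). -/
theorem stub_conjOnClosure :
    ∀ (g : ℕ) (P : surfaceGen g → Prop) (w : SurfaceGroup g) (T : SurfaceGroup g ≃* SurfaceGroup g),
      (∀ x : surfaceGen g, P x → T (PresentedGroup.of x) = w * PresentedGroup.of x * w⁻¹) →
      ∀ s ∈ Subgroup.closure ((fun x : surfaceGen g => (PresentedGroup.of x : SurfaceGroup g)) '' {x | P x}),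
        T s = w * s * w⁻¹ := by
  -- LANDED (wave 1, p82639, ACCEPTED) as Summit.SmoothPoincare4.SmoothPoincare4.Theorems.ShadowsStandard.PowerTwistAbsorption.stub_conjOnClosure;
  -- kept as `sorry` in this registration copy only until the farm has BUILT that module (import then discharges it,
  -- see work/ShadowsStandard.lean); nothing to prove here.
  sorry

/-- **STUB 3a · `stub_goeritzSigma23`** (Goeritz generator, def-free, genus 3): the involution
`σ₂₃ : a₁ ↦ a₁⁻¹, b₁ ↦ a₁b₁a₁⁻¹, a₂ ↦ b₃, b₂ ↦ a₃, a₃ ↦ b₂, b₃ ↦ a₂` is an automorphism of `S₃`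
(it sends the relator `r` to `[b₁,a₁] r⁻¹ [b₁,a₁]⁻¹`, `[x,y] = xyx⁻¹y⁻¹`; it is its own inverse)
stabilising `N₀ = ⟪a₁,a₂,b₃⟫` and `N₁ = ⟪a₁,b₂,a₃⟫`; on the face `F₃ = S₃ ⧸ N₀ = F⟨b₁,b₂,a₃⟩` it is
the swap `(x,y,z) ↦ (x,z,y)`. Formulas: idea card luft-twist-normal-form (ideator 3), verified by
triage r1-2 (`check_goeritz.py`) and in this seat (`comp/fg.py`). Template for the construction:
`swapEquiv` / `dehnEquiv` in `Theorems/WaldhausenPairs/Negative/StandardPairSymmetries.lean`. -/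
theorem stub_goeritzSigma23 :
    ∃ χ : SurfaceGroup 3 ≃* SurfaceGroup 3,
      χ (SurfaceGroup.a 0) = (SurfaceGroup.a 0)⁻¹ ∧
      χ (SurfaceGroup.b 0) = SurfaceGroup.a 0 * SurfaceGroup.b 0 * (SurfaceGroup.a 0)⁻¹ ∧
      χ (SurfaceGroup.a 1) = SurfaceGroup.b 2 ∧ χ (SurfaceGroup.b 1) = SurfaceGroup.a 2 ∧
      χ (SurfaceGroup.a 2) = SurfaceGroup.b 1 ∧ χ (SurfaceGroup.b 2) = SurfaceGroup.a 1 ∧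
      (s4Kernels 0).map χ.toMonoidHom = s4Kernels 0 ∧ (s4Kernels 1).map χ.toMonoidHom = s4Kernels 1 := by
  -- LANDED (wave 1, p79944, ACCEPTED) as Summit.SmoothPoincare4.SmoothPoincare4.Theorems.ShadowsStandard.PowerTwistAbsorption.stub_goeritzSigma23;
  -- kept as `sorry` in this registration copy only until the farm has BUILT that module (import then discharges it,
  -- see work/ShadowsStandard.lean); nothing to prove here.
  sorry

/-- **STUB 3b · `stub_goeritzS1`** (Goeritz generator, def-free, genus 3): the automorphism
`S₁ : a₁ ↦ a₁, b₁ ↦ b₂⁻¹a₁b₁, a₂ ↦ b₂⁻¹a₁a₂b₂, b₂ ↦ b₂, a₃ ↦ a₁b₂⁻¹a₃b₂a₁⁻¹, b₃ ↦ a₁b₂⁻¹b₃b₂a₁⁻¹`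
of `S₃` (relator `r ↦ (a₁b₂⁻¹) r (a₁b₂⁻¹)⁻¹`; inverse `b₁ ↦ a₁⁻¹b₂b₁, a₂ ↦ a₁⁻¹b₂a₂b₂⁻¹,
a₃ ↦ b₂a₁⁻¹a₃a₁b₂⁻¹, b₃ ↦ b₂a₁⁻¹b₃a₁b₂⁻¹`, `a₁, b₂` fixed, sending `r ↦ (b₂a₁⁻¹) r (b₂a₁⁻¹)⁻¹`)
stabilises `N₀` and `N₁`; on the face `F⟨x=b₁,y=b₂,z=a₃⟩` it is `x ↦ y⁻¹x, y ↦ y, z ↦ y⁻¹zy`. -/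
theorem stub_goeritzS1 :
    ∃ χ : SurfaceGroup 3 ≃* SurfaceGroup 3,
      χ (SurfaceGroup.a 0) = SurfaceGroup.a 0 ∧
      χ (SurfaceGroup.b 0) = (SurfaceGroup.b 1)⁻¹ * SurfaceGroup.a 0 * SurfaceGroup.b 0 ∧
      χ (SurfaceGroup.a 1) = (SurfaceGroup.b 1)⁻¹ * SurfaceGroup.a 0 * SurfaceGroup.a 1 * SurfaceGroup.b 1 ∧
      χ (SurfaceGroup.b 1) = SurfaceGroup.b 1 ∧
      χ (SurfaceGroup.a 2) = SurfaceGroup.a 0 * (SurfaceGroup.b 1)⁻¹ * SurfaceGroup.a 2 * SurfaceGroup.b 1 *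
        (SurfaceGroup.a 0)⁻¹ ∧
      χ (SurfaceGroup.b 2) = SurfaceGroup.a 0 * (SurfaceGroup.b 1)⁻¹ * SurfaceGroup.b 2 * SurfaceGroup.b 1 *
        (SurfaceGroup.a 0)⁻¹ ∧
      (s4Kernels 0).map χ.toMonoidHom = s4Kernels 0 ∧ (s4Kernels 1).map χ.toMonoidHom = s4Kernels 1 := by
  -- LANDED (wave 1, p80208, ACCEPTED) as Summit.SmoothPoincare4.SmoothPoincare4.Theorems.ShadowsStandard.PowerTwistAbsorption.stub_goeritzS1;
  -- kept as `sorry` in this registration copy only until the farm has BUILT that module (import then discharges it,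
  -- see work/ShadowsStandard.lean); nothing to prove here.
  sorry

/-- **STUB 3c · `stub_goeritzS2`** (Goeritz generator, def-free, genus 3): the automorphism
`S₂ : a₁ ↦ (b₃b₂)⁻¹a₁(b₃b₂), b₁ ↦ (b₃b₂)⁻¹b₁(b₃b₂), a₂ ↦ (b₃b₂)⁻¹a₂b₂, b₂ ↦ b₂, a₃ ↦ b₃⁻¹b₂⁻¹a₃b₃,
b₃ ↦ b₃` of `S₃` (relator `r ↦ (b₂⁻¹b₃⁻¹) r (b₂⁻¹b₃⁻¹)⁻¹`; inverse `a₁ ↦ (b₃b₂)a₁(b₃b₂)⁻¹,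
b₁ ↦ (b₃b₂)b₁(b₃b₂)⁻¹, a₂ ↦ (b₃b₂)a₂b₂⁻¹, a₃ ↦ b₂b₃a₃b₃⁻¹`, `b₂, b₃` fixed, sending
`r ↦ (b₃b₂) r (b₃b₂)⁻¹`) stabilises `N₀` and `N₁`; on the face it is `x ↦ y⁻¹xy, y ↦ y, z ↦ y⁻¹z`. -/
theorem stub_goeritzS2 :
    ∃ χ : SurfaceGroup 3 ≃* SurfaceGroup 3,
      χ (SurfaceGroup.a 0) = (SurfaceGroup.b 2 * SurfaceGroup.b 1)⁻¹ * SurfaceGroup.a 0 *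
        (SurfaceGroup.b 2 * SurfaceGroup.b 1) ∧
      χ (SurfaceGroup.b 0) = (SurfaceGroup.b 2 * SurfaceGroup.b 1)⁻¹ * SurfaceGroup.b 0 *
        (SurfaceGroup.b 2 * SurfaceGroup.b 1) ∧
      χ (SurfaceGroup.a 1) = (SurfaceGroup.b 2 * SurfaceGroup.b 1)⁻¹ * SurfaceGroup.a 1 * SurfaceGroup.b 1 ∧
      χ (SurfaceGroup.b 1) = SurfaceGroup.b 1 ∧
      χ (SurfaceGroup.a 2) = (SurfaceGroup.b 2)⁻¹ * (SurfaceGroup.b 1)⁻¹ * SurfaceGroup.a 2 * SurfaceGroup.b 2 ∧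
      χ (SurfaceGroup.b 2) = SurfaceGroup.b 2 ∧
      (s4Kernels 0).map χ.toMonoidHom = s4Kernels 0 ∧ (s4Kernels 1).map χ.toMonoidHom = s4Kernels 1 := by
  -- LANDED (wave 1, p80004, ACCEPTED) as Summit.SmoothPoincare4.SmoothPoincare4.Theorems.ShadowsStandard.PowerTwistAbsorption.stub_goeritzS2;
  -- kept as `sorry` in this registration copy only until the farm has BUILT that module (import then discharges it,
  -- see work/ShadowsStandard.lean); nothing to prove here.
  sorry

/-! ### Wave 2 (m = 0): the FACE NORMAL FORM at genus 3 — first infrastructure of the `(0,3)` rung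

After Waldhausen normalisation `K = (N₀, N₁, K₂)`, look at the face `F₃ = S₃ ⧸ N₀ = F⟨x=b₁, y=b₂, z=a₃⟩`
(`π₁` of the first handlebody). The pair axiom `free_pairQuotient 0 2` says `S ⧸ (N₀ ⊔ K₂) ≅ ℤ`, so
`K₂ ⊔ N₀ = ker f` for a surjective character `f : S₃ → ℤ` killing `N₀`, with values
`(v₁,v₂,v₃) = (f b₁, f b₂, f a₃)`; the triple axiom `N₀N₁K₂ = S` says `gcd(v₂,v₃) = 1`
(`N₁ ⊔ ker f = ⊤`). The three landed Goeritz elements act on such characters by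
`σ₂₃ : (v₁,v₂,v₃) ↦ (v₁,v₃,v₂)`, `S₁ : ↦ (v₁−v₂, v₂, v₃)`, `S₂ : ↦ (v₁, v₂, v₃−v₂)` (and inverses), so
the Euclidean algorithm carries `f` to `±(0,1,0)`, the character whose kernel is `N₂ ⊔ N₀`. Hence
(STUB F0, assembled here from STUBS F1–F3): for every normalised `(3;1)` group trisection of `{1}`
there is an EXACT Goeritz element `χ ∈ Stab N₀ ∩ Stab N₁` with `χ(N₂ ⊔ N₀) = K₂ ⊔ N₀` — the face of
a genus-3 trisection of a homotopy 4-sphere is standard (idea card luft-twist-normal-form step (i),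
line finitary-ac Stubs 1+2 at `m = 0`, exact form; no level `M` needed). This is unconditional
(no `WaldhausenPairs` beyond the normalisation hypothesis) and reduces the genus-3 gate / crux to
third kernels with `K₂N₀ = N₂N₀`. -/

/-- **STUB F1 · `stub_faceCharOfTrisection`** (def-free, genus 3): for a normalised `(3;1)` group
trisection `(N₀, N₁, K₂)` of the trivial group, `K₂ ⊔ N₀` is the kernel of a surjective character
`f : S₃ →* ℤ` killing `a₁, a₂, b₃` (i.e. `N₀`) with `N₁ ⊔ ker f = ⊤` (coprimality of `(f b₂, f a₃)`).
Route: `free_pairQuotient 0 2 : IsFreeOfRank (S ⧸ normalClosure (N₀ ∪ K₂)) 1` gives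
`e : FreeGroup (Fin 1) ≃* S ⧸ normalClosure (N₀ ∪ K₂)`; `f := (FreeGroup.lift fun _ => ofAdd 1) ∘ e⁻¹ ∘ mk`
(the lift `FreeGroup (Fin 1) →* Multiplicative ℤ` is bijective: `FreeGroup (Fin 1)` is generated by
one element), `ker f = normalClosure (N₀ ∪ K₂) = N₀ ⊔ K₂` (both normal: `hK.normal`), and
`N₁ ⊔ ker f = N₀ ⊔ N₁ ⊔ K₂ = ⊤` from `hK.triple` (`tripleQuotient ≃* PUnit` ⇒
`normalClosure (⋃ Kᵢ) = ⊤`). -/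
theorem stub_faceCharOfTrisection :
    ∀ K : TrisectionKernels 3, IsGroupTrisection 3 1 (PUnit : Type) K →
      K 0 = s4Kernels 0 → K 1 = s4Kernels 1 →
      ∃ f : SurfaceGroup 3 →* Multiplicative ℤ,
        f (SurfaceGroup.a 0) = 1 ∧ f (SurfaceGroup.a 1) = 1 ∧ f (SurfaceGroup.b 2) = 1 ∧
        Function.Surjective f ∧ s4Kernels 1 ⊔ f.ker = ⊤ ∧ f.ker = K 2 ⊔ s4Kernels 0 := by
  sorry

/-- **STUB F2 · `stub_faceEuclid`** (def-free, genus 3; the Euclidean algorithm on the face): every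
surjective character `f : S₃ →* ℤ` killing `a₁, a₂, b₃` with `N₁ ⊔ ker f = ⊤` (i.e. `gcd(f b₂, f a₃) = 1`)
is carried by an automorphism `χ` stabilising `N₀` AND `N₁` to `±` the standard face character
(`b₂ ↦ 1`, every other generator `↦ 0`). Route: induction on `|f b₂| + |f a₃|` then on `|f b₁|`,
using the landed Goeritz elements `stub_goeritzSigma23` (`(v₁,v₂,v₃) ↦ (v₁,v₃,v₂)`),
`stub_goeritzS2` (`↦ (v₁,v₂,v₃−v₂)`; its inverse `↦ (v₁,v₂,v₃+v₂)`), `stub_goeritzS1`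
(`↦ (v₁−v₂,v₂,v₃)`; inverse `↦ (v₁+v₂,v₂,v₃)`), where `vᵢ` are the values of the current character
`f ∘ χ` on `b₁, b₂, a₃`; each move keeps "kills `a₁,a₂,b₃`" (the elements stabilise `N₀ ≤ ker`),
surjectivity and `N₁ ⊔ ker = ⊤`. -/
theorem stub_faceEuclid :
    ∀ f : SurfaceGroup 3 →* Multiplicative ℤ,
      f (SurfaceGroup.a 0) = 1 → f (SurfaceGroup.a 1) = 1 → f (SurfaceGroup.b 2) = 1 →
      Function.Surjective f → s4Kernels 1 ⊔ f.ker = ⊤ →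
      ∃ χ : SurfaceGroup 3 ≃* SurfaceGroup 3,
        (s4Kernels 0).map χ.toMonoidHom = s4Kernels 0 ∧ (s4Kernels 1).map χ.toMonoidHom = s4Kernels 1 ∧
        f (χ (SurfaceGroup.a 0)) = 1 ∧ f (χ (SurfaceGroup.a 1)) = 1 ∧ f (χ (SurfaceGroup.a 2)) = 1 ∧
        f (χ (SurfaceGroup.b 0)) = 1 ∧ f (χ (SurfaceGroup.b 2)) = 1 ∧
        (f (χ (SurfaceGroup.b 1)) = Multiplicative.ofAdd 1 ∨
          f (χ (SurfaceGroup.b 1)) = Multiplicative.ofAdd (-1)) := by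
  sorry

/-- **STUB F3 · `stub_kerFaceChar`** (def-free, genus 3): the kernel of `±` the standard face character
(`b₂ ↦ ±1`, all other generators `↦ 0`) is `N₂ ⊔ N₀ = ⟪b₁,a₂,a₃⟫ ⊔ ⟪a₁,a₂,b₃⟫`. Route: `⊇` from the
generator values; `⊆`: `S₃ ⧸ (N₂ ⊔ N₀)` is the free group on the surviving generator `b₂`
(`quotientEquivFreeGroupErase` with the erased set `{a₁,a₂,a₃,b₁,b₃}`), on which the induced
character is injective. -/
theorem stub_kerFaceChar :
    ∀ f : SurfaceGroup 3 →* Multiplicative ℤ,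
      f (SurfaceGroup.a 0) = 1 → f (SurfaceGroup.a 1) = 1 → f (SurfaceGroup.a 2) = 1 →
      f (SurfaceGroup.b 0) = 1 → f (SurfaceGroup.b 2) = 1 →
      (f (SurfaceGroup.b 1) = Multiplicative.ofAdd 1 ∨ f (SurfaceGroup.b 1) = Multiplicative.ofAdd (-1)) →
      f.ker = s4Kernels 2 ⊔ s4Kernels 0 := by
  sorry

/-- **STUB F0 · `stub_faceNormalFormGenusThree`** (held by the lead; assembled from F1–F3 below and
landed once they land): for every Waldhausen-normalised `(3;1)` group trisection `(N₀, N₁, K₂)` of the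
trivial group there is an exact Goeritz element `χ ∈ Stab N₀ ∩ Stab N₁` with
`χ(N₂ ⊔ N₀) = K₂ ⊔ N₀`: the `H₀`-face of a genus-3 trisection of a homotopy 4-sphere is standard. -/
theorem faceNormalFormGenusThree_of_pieces :
    ∀ K : TrisectionKernels 3, IsGroupTrisection 3 1 (PUnit : Type) K →
      K 0 = s4Kernels 0 → K 1 = s4Kernels 1 →
      ∃ χ : SurfaceGroup 3 ≃* SurfaceGroup 3,
        (s4Kernels 0).map χ.toMonoidHom = s4Kernels 0 ∧ (s4Kernels 1).map χ.toMonoidHom = s4Kernels 1 ∧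
        (s4Kernels 2 ⊔ s4Kernels 0).map χ.toMonoidHom = K 2 ⊔ s4Kernels 0 := by
  intro K hK h0 h1
  obtain ⟨f, fa0, fa1, fb2, hsurj, hN1, hker⟩ := stub_faceCharOfTrisection K hK h0 h1
  obtain ⟨χ, hχ0, hχ1, ga0, ga1, ga2, gb0, gb2, gb1⟩ := stub_faceEuclid f fa0 fa1 fb2 hsurj hN1
  have hker' : (f.comp χ.toMonoidHom).ker = s4Kernels 2 ⊔ s4Kernels 0 :=
    stub_kerFaceChar (f.comp χ.toMonoidHom) ga0 ga1 ga2 gb0 gb2 gb1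
  refine ⟨χ, hχ0, hχ1, ?_⟩
  rw [← hker, ← hker', ← MonoidHom.comap_ker]
  -- `χ (χ⁻¹ (ker f)) = ker f`
  exact Subgroup.map_comap_eq_self_of_surjective (f := χ.toMonoidHom) χ.surjective _

/-- **STUB F0 (registered) · `stub_faceNormalFormGenusThree`** — identical statement; PROVED above from
F1–F3 (`faceNormalFormGenusThree_of_pieces`); kept `sorry` in this registration copy so that the lead can
land the assembled file under this name once F1–F3 have landed. -/
theorem stub_faceNormalFormGenusThree :
    ∀ K : TrisectionKernels 3, IsGroupTrisection 3 1 (PUnit : Type) K →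
      K 0 = s4Kernels 0 → K 1 = s4Kernels 1 →
      ∃ χ : SurfaceGroup 3 ≃* SurfaceGroup 3,
        (s4Kernels 0).map χ.toMonoidHom = s4Kernels 0 ∧ (s4Kernels 1).map χ.toMonoidHom = s4Kernels 1 ∧
        (s4Kernels 2 ⊔ s4Kernels 0).map χ.toMonoidHom = K 2 ⊔ s4Kernels 0 := by
  sorry

/-! ### The two rungs of STUB 1 (named `Prop`s, special cases — not registered obligations) -/

/-- RUNG `e = 2` of STUB 1 (the calibration rung, all `m`): the mod-2 gate. `Mod_g[2]` is the
level-2 principal congruence kernel (Humphries 1992 Prop 2.1), so this is the 𝔽₂-Lagrangian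
statement `ρ̄ ∈ Im(A∩B)·Im(C) ⊆ Sp(2g,𝔽₂)` on the gate locus (route support `AbelianShadowStandard`
plus the Goeritz image lemma `Im(A∩B → Sp(2g,ℤ)) = Stab L₀ ∩ Stab L₁`). -/
def RungExponentTwo : Prop :=
  ∀ (m : ℕ) (K : TrisectionKernels (3 + 3 * m)),
    IsGroupTrisection (3 + 3 * m) (m + 1) (PUnit : Type) K → K 0 = N m 0 → K 1 = N m 1 →
    ∃ y t c : Sg m ≃* Sg m,
      (N m 0).map y.toMonoidHom = N m 0 ∧ (N m 1).map y.toMonoidHom = N m 1 ∧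
      t ∈ powerTwists m 2 ∧ (N m 2).map c.toMonoidHom = N m 2 ∧
      K 2 = (((N m 2).map c.toMonoidHom).map t.toMonoidHom).map y.toMonoidHom

/-- RUNG `(m,e) = (0,3)` of STUB 1 (DECIDABLE in principle: Humphries 1992 Thm 2, `Mod₃/⟪T³⟫` finite):
the mod-3 gate at genus 3, the first open trisection type `(3;1,1,1)`; the drefuter's finite target.
Its first infrastructure is STUBS 3a–3c (Goeritz generators of `(N₀,N₁)` as automorphisms). -/
def RungGenusThreeExponentThree : Prop :=
  ∀ K : TrisectionKernels 3,
    IsGroupTrisection 3 1 (PUnit : Type) K → K 0 = s4Kernels 0 → K 1 = s4Kernels 1 →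
    ∃ y t c : SurfaceGroup 3 ≃* SurfaceGroup 3,
      (s4Kernels 0).map y.toMonoidHom = s4Kernels 0 ∧ (s4Kernels 1).map y.toMonoidHom = s4Kernels 1 ∧
      t ∈ powerTwists 0 3 ∧ (s4Kernels 2).map c.toMonoidHom = s4Kernels 2 ∧
      K 2 = (((s4Kernels 2).map c.toMonoidHom).map t.toMonoidHom).map y.toMonoidHom

theorem powerTwistGate_holds : PowerTwistGate := stub_powerTwistGate

/-- The two rungs are literally special cases of STUB 1. -/
theorem rungs_of_powerTwistGate (h : PowerTwistGate) : RungExponentTwo ∧ RungGenusThreeExponentThree :=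
  ⟨fun m => h m 2 le_rfl, fun K hK h0 h1 => h 0 3 (by norm_num) K hK h0 h1⟩

/-! ## §4½ The lever PROVED from the pieces: `TwistAbsorption` -/

/-- The boundary word lies in the subgroup generated by the standard generators of the first `h`
handles. -/
theorem boundaryWord_mem_closure (m h : ℕ) :
    boundaryWord m h ∈ Subgroup.closure
      ((fun x : surfaceGen (3 + 3 * m) => (PresentedGroup.of x : Sg m)) '' {x | x.1.val < h}) := by
  unfold boundaryWord
  rw [map_list_prod, List.map_map]
  refine list_prod_mem ?_
  intro y hy
  rw [List.mem_map] at hy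
  obtain ⟨i, hi, rfl⟩ := hy
  rw [List.mem_filter] at hi
  have hi' : i.val < h := by simpa using hi.2
  have ha : (PresentedGroup.of (i, false) : Sg m) ∈ Subgroup.closure
      ((fun x : surfaceGen (3 + 3 * m) => (PresentedGroup.of x : Sg m)) '' {x | x.1.val < h}) :=
    Subgroup.subset_closure ⟨(i, false), hi', rfl⟩
  have hb : (PresentedGroup.of (i, true) : Sg m) ∈ Subgroup.closure
      ((fun x : surfaceGen (3 + 3 * m) => (PresentedGroup.of x : Sg m)) '' {x | x.1.val < h}) :=
    Subgroup.subset_closure ⟨(i, true), hi', rfl⟩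
  simp only [Function.comp_apply, map_mul, map_inv]
  exact Subgroup.mul_mem _ (Subgroup.mul_mem _ (Subgroup.mul_mem _ ha hb) (Subgroup.inv_mem _ ha))
    (Subgroup.inv_mem _ hb)

/-- A separating twist fixes its boundary word (from STUB 2c). -/
theorem sepTwist_boundaryWord {m : ℕ} {h : ℕ} {T : Sg m ≃* Sg m} (hT : IsSepTwist h T) :
    T (boundaryWord m h) = boundaryWord m h := by
  have key := stub_conjOnClosure (3 + 3 * m) (fun x => x.1.val < h) (boundaryWord m h) T
    (fun x hx => by rw [hT x, if_pos hx]) _ (boundaryWord_mem_closure m h)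
  rw [key, mul_inv_cancel_right]

/-- The `e`-th power of a based Dehn-twist automorphism is congruent to the identity modulo any
normal `M` with `s ^ e ∈ M` for all `s` (from STUBS 2a, 2b, 2c). -/
theorem congruentMod_pow_of_isDehnTwist_base {m e : ℕ} {M : Subgroup (Sg m)} [M.Normal]
    (he : ∀ s : Sg m, s ^ e ∈ M) {T₀ : Sg m ≃* Sg m}
    (hT₀ : IsStdTwist T₀ ∨ ∃ h : ℕ, IsSepTwist h T₀) : CongruentMod M (T₀ ^ e) := by
  rcases hT₀ with hstd | ⟨h, hsep⟩
  · exact stub_transvectionPowCongruent (3 + 3 * m) e (h0 m) M inferInstance T₀ hstd (he _)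
  · exact stub_partialConjPowCongruent (3 + 3 * m) e (fun x => x.1.val < h) (boundaryWord m h) M
      inferInstance T₀ hsep (sepTwist_boundaryWord hsep) (he _)

/-- **The lever, proved** (was the planner's `stub_twistAbsorption`): for `M` characteristic with
`s ^ e ∈ M` for all `s`, every element of `powerTwists m e` is congruent to the identity modulo `M`.
`Characteristic` is consumed by `congruenceKernel_normal` (conjugation invariance). -/
theorem twistAbsorption_holds : TwistAbsorption := by
  intro m e M hM he t ht
  haveI : M.Normal := by haveI := hM; infer_instance
  haveI := congruenceKernel_normal hM
  have hle : powerTwists m e ≤ congruenceKernel M := by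
    refine Subgroup.normalClosure_le_normal ?_
    rintro _ ⟨T, ⟨φ, T₀, hT₀, rfl⟩, rfl⟩
    rw [SetLike.mem_coe, mem_congruenceKernel, conj_pow]
    exact CongruentMod.conj hM (congruentMod_pow_of_isDehnTwist_base he hT₀) φ
  exact hle ht

/-! ## §5 Proved glue -/

/-- `FiniteIndex` is consumed here: a characteristic finite-index `M` is killed by some `e ≥ 2`
(`e = 2·[S:M]`, `Subgroup.pow_index_mem`). -/
theorem exists_exponent {m : ℕ} (M : Subgroup (Sg m)) (hM : M.Characteristic) (hMf : M.FiniteIndex) :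
    ∃ e : ℕ, 2 ≤ e ∧ ∀ s : Sg m, s ^ e ∈ M := by
  haveI := hM
  refine ⟨2 * M.index, ?_, fun s => ?_⟩
  · have := hMf.index_ne_zero
    omega
  · rw [pow_mul']
    exact M.pow_mem (M.pow_index_mem s) 2

/-- The gate and the lever give the mod-`M` gate at every characteristic finite-index level. -/
theorem congruenceGate_of (hG : PowerTwistGate) (hA : TwistAbsorption) : CongruenceGate := by
  intro m K hK hK0 hK1 M hM hMf
  obtain ⟨e, he2, he⟩ := exists_exponent M hM hMf
  obtain ⟨y, t, c, hy0, hy1, ht, hc, hK2⟩ := hG m e he2 K hK hK0 hK1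
  exact ⟨y, t, c, hy0, hy1, hA m e M hM he t ht, hc, hK2⟩

/-- **Mod-`M` gate criterion** (ideator's sketch, proved): `K = (N₀, N₁, y(t(c(N₂))))` with `y`
stabilising `N₀`, `N₁` and `M`, `t ≡ id (mod M)`, `c` stabilising `N₂` has a standard level-`M`
shadow, witnessed by `ψ = y`. -/
theorem shadowStandardAt_of_gateFactorisation {m : ℕ} (M : Subgroup (Sg m))
    (K : TrisectionKernels (3 + 3 * m)) (y t c : Sg m ≃* Sg m)
    (hK0 : K 0 = N m 0) (hK1 : K 1 = N m 1)
    (hK2 : K 2 = (((N m 2).map c.toMonoidHom).map t.toMonoidHom).map y.toMonoidHom)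
    (hy0 : (N m 0).map y.toMonoidHom = N m 0)
    (hy1 : (N m 1).map y.toMonoidHom = N m 1)
    (hyM : M.map y.toMonoidHom = M) (ht : CongruentMod M t)
    (hc : (N m 2).map c.toMonoidHom = N m 2) :
    ShadowStandardAt m K M := by
  have htM : M.map t.toMonoidHom = M := map_eq_of_congruentMod M t ht
  have hbase : (N m 2).map t.toMonoidHom ⊔ M = N m 2 ⊔ M := by
    calc (N m 2).map t.toMonoidHom ⊔ M
        = (N m 2).map t.toMonoidHom ⊔ M.map t.toMonoidHom := by rw [htM]
      _ = (N m 2 ⊔ M).map t.toMonoidHom := (Subgroup.map_sup _ _ _).symm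
      _ = N m 2 ⊔ M := map_sup_eq_of_congruentMod M t ht _
  refine ⟨y, ?_⟩
  intro i
  fin_cases i
  · change (N m 0 ⊔ M).map y.toMonoidHom = K 0 ⊔ M
    rw [Subgroup.map_sup, hy0, hyM, hK0]
  · change (N m 1 ⊔ M).map y.toMonoidHom = K 1 ⊔ M
    rw [Subgroup.map_sup, hy1, hyM, hK1]
  · change (N m 2 ⊔ M).map y.toMonoidHom = K 2 ⊔ M
    rw [hK2, hc, ← hbase, Subgroup.map_sup, hyM]

/-- The mod-`M` gate gives the crux on NORMALISED triples. -/
theorem shadowStandardAt_of_normalised (hC : CongruenceGate) {m : ℕ}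
    {K : TrisectionKernels (3 + 3 * m)} (hK : IsGroupTrisection (3 + 3 * m) (m + 1) (PUnit : Type) K)
    (hK0 : K 0 = N m 0) (hK1 : K 1 = N m 1)
    (M : Subgroup (Sg m)) (hM : M.Characteristic) (hMf : M.FiniteIndex) :
    ShadowStandardAt m K M := by
  obtain ⟨y, t, c, hy0, hy1, ht, hc, hK2⟩ := hC m K hK hK0 hK1 M hM hMf
  exact shadowStandardAt_of_gateFactorisation M K y t c hK0 hK1 hK2 hy0 hy1
    ((characteristic_iff_map_eq.1 hM) y) ht hc

/-- Transport: the crux for `K` follows from the normalised case for `α⁻¹ • K`, where `α`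
standardises the pair `(K₀, K₁)` (the landed `IsGroupTrisection.map_mulEquiv` moves the hypothesis;
`M.Characteristic` is used once more to move `M`). -/
theorem shadowStandardAt_of_pair (hC : CongruenceGate) {m : ℕ}
    {K : TrisectionKernels (3 + 3 * m)} (hK : IsGroupTrisection (3 + 3 * m) (m + 1) (PUnit : Type) K)
    (α : Sg m ≃* Sg m) (hα0 : (N m 0).map α.toMonoidHom = K 0) (hα1 : (N m 1).map α.toMonoidHom = K 1)
    (M : Subgroup (Sg m)) (hM : M.Characteristic) (hMf : M.FiniteIndex) :
    ShadowStandardAt m K M := by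
  let K' : TrisectionKernels (3 + 3 * m) := fun i => (K i).map α.symm.toMonoidHom
  have hK' : IsGroupTrisection (3 + 3 * m) (m + 1) (PUnit : Type) K' :=
    Summit.SmoothPoincare4.SmoothPoincare4.Theorems.WaldhausenPairs.Negative.IsGroupTrisection.map_mulEquiv
      hK α.symm
  have hcomp : α.toMonoidHom.comp α.symm.toMonoidHom = MonoidHom.id (Sg m) := by
    ext s; simp
  have hcomp' : α.symm.toMonoidHom.comp α.toMonoidHom = MonoidHom.id (Sg m) := by
    ext s; simp
  have back : ∀ i, (K' i).map α.toMonoidHom = K i := fun i => by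
    change ((K i).map α.symm.toMonoidHom).map α.toMonoidHom = K i
    rw [Subgroup.map_map, hcomp, Subgroup.map_id]
  have hK'0 : K' 0 = N m 0 := by
    change (K 0).map α.symm.toMonoidHom = N m 0
    rw [← hα0, Subgroup.map_map, hcomp', Subgroup.map_id]
  have hK'1 : K' 1 = N m 1 := by
    change (K 1).map α.symm.toMonoidHom = N m 1
    rw [← hα1, Subgroup.map_map, hcomp', Subgroup.map_id]
  obtain ⟨ψ, hψ⟩ := shadowStandardAt_of_normalised hC hK' hK'0 hK'1 M hM hMf
  refine ⟨ψ.trans α, fun i => ?_⟩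
  have htr : (ψ.trans α).toMonoidHom = α.toMonoidHom.comp ψ.toMonoidHom := rfl
  rw [htr, ← Subgroup.map_map, hψ i, Subgroup.map_sup, back i, (characteristic_iff_map_eq.1 hM) α]

/-! ## §6 The composition: STUB 1 + the proved lever + the route item `WaldhausenPairs` imply the
crux, BY NAME (no `sorry` outside `stub_*`) -/

/-- `ShadowsStandard` from STUB 1 (mod-`e` gate, `stub_powerTwistGate`), the lever PROVED from STUBS
2a–2c (`twistAbsorption_holds`) and the route's own crux `WaldhausenPairs` (stmt-SmoothPoincare4-14592,
pair normalisation; used only for the pair `(0,1)`). -/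
theorem ShadowsStandard_of (hW : WaldhausenPairs) : ShadowsStandard := by
  intro m K hK M hM hMf
  obtain ⟨α, hα0, hα1⟩ := hW m K hK 0 1 (by decide)
  exact shadowStandardAt_of_pair (congruenceGate_of stub_powerTwistGate twistAbsorption_holds)
    hK α hα0 hα1 M hM hMf

end Summit.SmoothPoincare4.SmoothPoincare4.Cruxes.ShadowsStandard.PowerTwistAbsorption

end
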